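import Summits.NavierStokesRegularity.NavierStokesRegularity.Theorems.LerayQuarterDissipationFiniteDissipationLiouvillePlanarityFloor
import Summits.NavierStokesRegularity.NavierStokesRegularity.Theorems.LerayQuarterDissipationFiniteDissipationLiouvilleVorticityAlignment
import HarnessLib

/-!
# Crux `FiniteDissipationLiouville` (stmt-NavierStokesRegularity-22144): the UNIDIRECTIONALITY
# FLOOR — near a finite-dissipation Type-I singularity the flow is never nearly unidirectional
# (parallel shear-flow regime excluded, quantitatively, at every scale)

Theorems file of route `LerayQuarterDissipation` (lead prover ns-lqd-lead g8; `--supports` the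
crux, line `birth`; portrait facts for the registered stub `stub_envelopeCriticalLiouville`).
Navier–Stokes regularity is NOT proved by anything here; no summit is.

`𝒟_{C,K}`: Type-I ancient mild fields (KNSS gauge, `IsTypeIAncientMild C w`) with the law
`∫ ‖∇w(s)‖² ≤ K/√(−s)`. The scale-invariant velocity size is `√(−t)‖w(t,x)‖`; the velocity
direction is `û = w/‖w‖` (written `‖w t x‖⁻¹ • w t x`).

* `slice_eq_zero_of_velocity_parallel` — a member of `𝒟_{C,K}` whose velocity at ONE instant is
  everywhere parallel to ONE fixed line (`w(s,x) = c(x) e`: a parallel / shear-flow slice, signs and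
  zeros free) vanishes at that instant: `div w = ∂ₑc = 0` makes the slice two-dimensional
  (`Planarity.slice_eq_zero_of_fderiv_apply_eq_zero`);
* `false_of_unidirectional_seq` — compactness core: no sequence of SINGULAR members is
  asymptotically unidirectional MODULO SIGN at `t = −1` on growing balls above vanishing levels;
* `unidirectionality_leaf` — **ONE-SLICE LEAF with `δ = δ(C,K) > 0`**: `δ`-coherence modulo sign
  of `û` on the `δ`-fast part (`√(−t)‖w‖ > δ`) of ONE parabolic ball `B(0, δ⁻¹√(−t))` at ONE
  instant forces boundedness at the apex;
* `unidirectionality_floor_of_singular` — contrapositive, **portrait clause: at EVERY instant a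
  singular member carries two points of `B(0, δ⁻¹√(−t))` with `√(−t)‖w‖ > δ` whose velocity
  directions are `δ`-apart modulo sign** (the exact parallel shear flows `(f(t,x₂,x₃),0,0)` — heat
  equation — are the model of the excluded regime).

HONEST FRAMING. `δ(C,K)` by compactness; portrait fact; no DSS scenario with genuinely
three-dimensional profile is removed.

References: Koch–Nadirashvili–Seregin–Šverák 2009, §4; Giga–Miura 2011 (direction-coherence
template).
-/

noncomputable section

-- the summit and its single sub-problem share the name (CONVENTIONS §1), as in every Theorems file
set_option linter.dupNamespace false

namespace Summit.NavierStokesRegularity.NavierStokesRegularity.Theorems.FiniteDissipationLiouville.Unidirectional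

open MeasureTheory Set Filter Topology Metric Function
open Literature.Analysis Literature.Analysis.FluidPDE
open Summit.NavierStokesRegularity.NavierStokesRegularity.Theorems.FiniteDissipationLiouville
open scoped ENNReal NNReal RealInnerProductSpace

/-! ### A unidirectional slice vanishes -/

/-- **A member of `𝒟_{C,K}` whose velocity at ONE instant is everywhere parallel to one fixed line
vanishes at that instant**: with `w(s) = c • e`, `e ≠ 0`, incompressibility gives `∂ₑ c = div w = 0`,
so the slice is independent of the direction `e` and `Planarity.slice_eq_zero_of_fderiv_apply_eq_zero`
applies. [cite: KochNadirashviliSereginSverak2009, Thm 5.1 (arXiv:0709.3599 p. 9)] -/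
theorem slice_eq_zero_of_velocity_parallel {C K : ℝ}
    {w : ℝ → EuclideanSpace ℝ (Fin 3) → EuclideanSpace ℝ (Fin 3)}
    (hw : IsTypeIAncientMild C w)
    (hlaw : ∀ s : ℝ, s < 0 → ∫⁻ x, ‖fderiv ℝ (w s) x‖ₑ ^ 2 ≤ ENNReal.ofReal (K / Real.sqrt (-s)))
    {s : ℝ} (hs : s < 0) (e : EuclideanSpace ℝ (Fin 3))
    (hpar : ∀ x, ∃ c : ℝ, w s x = c • e) : ∀ x, w s x = 0 := by
  by_cases he : e = 0
  · intro x
    obtain ⟨c, hc⟩ := hpar x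
    rw [hc, he, smul_zero]
  have hdiff : Differentiable ℝ (w s) :=
    ((hw.contDiff_slice hs).of_le (WithTop.coe_le_coe.2 le_top) : ContDiff ℝ 1 (w s)).differentiable
      one_ne_zero
  have hen : ‖e‖ ≠ 0 := norm_ne_zero_iff.2 he
  -- the coefficient `f` with `w(s) = f • e`
  set f : EuclideanSpace ℝ (Fin 3) → ℝ := fun x => (‖e‖ ^ 2)⁻¹ * ⟪w s x, e⟫ with hf_def
  have hf : ∀ x, w s x = f x • e := by
    intro x
    obtain ⟨c, hc⟩ := hpar x
    have : f x = c := by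
      rw [hf_def]
      simp only
      rw [hc, inner_smul_left, real_inner_self_eq_norm_sq, RCLike.conj_to_real]
      field_simp
    rw [this, hc]
  have hfun : w s = fun x => f x • e := funext hf
  have hfdiff : Differentiable ℝ f := by
    have h := (hdiff.inner ℝ (differentiable_const e)).const_mul ((‖e‖ ^ 2)⁻¹)
    rw [hf_def]
    exact h
  -- incompressibility: `∂ₑ f = div (f e) = 0`
  have hfe : ∀ x, fderiv ℝ f x e = 0 := by
    intro x
    have h0 := hw.isDivFree hs x
    rw [VectorCalculus.divergence, hfun, fderiv_smul_const (hfdiff x) e] at h0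
    rwa [show (((fderiv ℝ f x).smulRight e : EuclideanSpace ℝ (Fin 3) →L[ℝ] EuclideanSpace ℝ (Fin 3)) :
        EuclideanSpace ℝ (Fin 3) →ₗ[ℝ] EuclideanSpace ℝ (Fin 3)) =
        (fderiv ℝ f x : EuclideanSpace ℝ (Fin 3) →ₗ[ℝ] ℝ).smulRight e from rfl,
      LinearMap.trace_smulRight] at h0
  -- hence the slice is two-dimensional
  have hplanar : ∀ x, fderiv ℝ (w s) x e = 0 := by
    intro x
    rw [hfun, fderiv_smul_const (hfdiff x) e, ContinuousLinearMap.smulRight_apply, hfe, zero_smul]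
  exact Planarity.slice_eq_zero_of_fderiv_apply_eq_zero hw hlaw hs he hplanar

/-- **A member of `𝒟_{C,K}` with ONE unidirectional slice is bounded at the apex.**
[cite: KochNadirashviliSereginSverak2009, Thm 5.1 (arXiv:0709.3599 p. 9)] -/
theorem not_singular_of_velocity_parallel_slice {C K : ℝ}
    {w : ℝ → EuclideanSpace ℝ (Fin 3) → EuclideanSpace ℝ (Fin 3)}
    (hw : IsTypeIAncientMild C w)
    (hlaw : ∀ s : ℝ, s < 0 → ∫⁻ x, ‖fderiv ℝ (w s) x‖ₑ ^ 2 ≤ ENNReal.ofReal (K / Real.sqrt (-s)))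
    {s : ℝ} (hs : s < 0) (e : EuclideanSpace ℝ (Fin 3))
    (hpar : ∀ x, ∃ c : ℝ, w s x = c • e) :
    ¬ (∀ r > 0, ∀ M : ℝ, ∃ t ∈ Ioo (-(r ^ 2)) (0 : ℝ),
        ∃ x ∈ ball (0 : EuclideanSpace ℝ (Fin 3)) r, M < ‖w t x‖) :=
  CalmSlice.not_singular_of_zero_slice hw hs (slice_eq_zero_of_velocity_parallel hw hlaw hs e hpar)

/-! ### The compactness core -/

/-- **No sequence of singular members of `𝒟_{C,K}` is asymptotically unidirectional (mod sign) at
`t = −1` on growing balls above vanishing levels**: the KNSS limit (values converge pointwise; law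
and singularity persist; normalisation is continuous off zero) would have a unidirectional slice,
which vanishes. [cite: KochNadirashviliSereginSverak2009, §4 (arXiv:0709.3599 p. 8)] -/
theorem false_of_unidirectional_seq {C K : ℝ}
    {w : ℕ → ℝ → EuclideanSpace ℝ (Fin 3) → EuclideanSpace ℝ (Fin 3)}
    (hwk : ∀ k, IsTypeIAncientMild C (w k))
    (hlaw : ∀ k, ∀ s : ℝ, s < 0 →
      ∫⁻ x, ‖fderiv ℝ (w k s) x‖ₑ ^ 2 ≤ ENNReal.ofReal (K / Real.sqrt (-s)))
    (hsing : ∀ k, ∀ ρ > 0, ∀ M : ℝ, ∃ t ∈ Ioo (-(ρ ^ 2)) (0 : ℝ),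
      ∃ x ∈ ball (0 : EuclideanSpace ℝ (Fin 3)) ρ, M < ‖w k t x‖)
    (halign : ∀ k : ℕ, ∀ x ∈ ball (0 : EuclideanSpace ℝ (Fin 3)) ((k : ℝ) + 1),
      ∀ y ∈ ball (0 : EuclideanSpace ℝ (Fin 3)) ((k : ℝ) + 1),
        1 / ((k : ℝ) + 1) < ‖w k (-1) x‖ → 1 / ((k : ℝ) + 1) < ‖w k (-1) y‖ →
        min ‖‖w k (-1) x‖⁻¹ • w k (-1) x - ‖w k (-1) y‖⁻¹ • w k (-1) y‖
            ‖‖w k (-1) x‖⁻¹ • w k (-1) x + ‖w k (-1) y‖⁻¹ • w k (-1) y‖ ≤ 1 / ((k : ℝ) + 1)) :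
    False := by
  obtain ⟨ψ, hψ, W, hW, hunif, hval, hgrad⟩ := Compactness.seqLimit hwk
  have hψt : Tendsto ψ atTop atTop := hψ.tendsto_atTop
  have hWlaw : ∀ s : ℝ, s < 0 →
      ∫⁻ x, ‖fderiv ℝ (W s) x‖ₑ ^ 2 ≤ ENNReal.ofReal (K / Real.sqrt (-s)) :=
    Compactness.law_of_seqLimit (Kinf := K) (Kk := fun _ => K) hψt hlaw
      (fun ε hε => Eventually.of_forall fun _ => by linarith) hgrad
  have hWsing := Compactness.persistent_singularity_seq (w := fun j => w (ψ j))
    (fun j => hwk (ψ j)) (fun j => hlaw (ψ j)) (fun j => hsing (ψ j)) hW hunif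
  have h1 : (-1 : ℝ) < 0 := by norm_num
  have hv : ∀ z, Tendsto (fun j => w (ψ j) (-1) z) atTop (𝓝 (W (-1) z)) := fun z => hval (-1) h1 z
  have hδ : Tendsto (fun j => 1 / ((ψ j : ℝ) + 1)) atTop (𝓝 0) :=
    (tendsto_one_div_add_atTop_nhds_zero_nat (𝕜 := ℝ)).comp hψt
  have hR : Tendsto (fun j => (ψ j : ℝ) + 1) atTop atTop :=
    tendsto_atTop_add_const_right _ 1 (tendsto_natCast_atTop_atTop.comp hψt)
  have hev_ball : ∀ z : EuclideanSpace ℝ (Fin 3), ∀ᶠ j in atTop,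
      z ∈ ball (0 : EuclideanSpace ℝ (Fin 3)) ((ψ j : ℝ) + 1) := fun z => by
    filter_upwards [hR.eventually_gt_atTop ‖z‖] with j hj
    exact mem_ball_zero_iff.2 hj
  have hev_level : ∀ z : EuclideanSpace ℝ (Fin 3), W (-1) z ≠ 0 → ∀ᶠ j in atTop,
      1 / ((ψ j : ℝ) + 1) < ‖w (ψ j) (-1) z‖ := by
    intro z hz
    have hpos : 0 < ‖W (-1) z‖ / 2 := by positivity
    have h2 : ∀ᶠ j in atTop, ‖W (-1) z‖ / 2 < ‖w (ψ j) (-1) z‖ :=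
      ((hv z).norm).eventually (lt_mem_nhds (by linarith [norm_pos_iff.2 hz]))
    filter_upwards [h2, hδ.eventually (gt_mem_nhds hpos)] with j hj hj'
    exact hj'.trans hj
  -- Case A: the limit slice vanishes identically
  by_cases hA : ∀ z, W (-1) z = 0
  · exact CalmSlice.not_singular_of_zero_slice hW h1 hA hWsing
  -- Case B: a point of nonzero limit velocity fixes the direction `e`
  push Not at hA
  obtain ⟨z₀, hz₀⟩ := hA
  set e : EuclideanSpace ℝ (Fin 3) := ‖W (-1) z₀‖⁻¹ • W (-1) z₀ with he_def
  have hpar : ∀ z, ∃ c : ℝ, W (-1) z = c • e := by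
    intro z
    by_cases hz : W (-1) z = 0
    · exact ⟨0, by rw [hz, zero_smul]⟩
    have hξz : Tendsto (fun j => ‖w (ψ j) (-1) z‖⁻¹ • w (ψ j) (-1) z) atTop
        (𝓝 (‖W (-1) z‖⁻¹ • W (-1) z)) := VorticityAlignment.tendsto_unitDir (hv z) hz
    have hξz₀ : Tendsto (fun j => ‖w (ψ j) (-1) z₀‖⁻¹ • w (ψ j) (-1) z₀) atTop (𝓝 e) := by
      rw [he_def]
      exact VorticityAlignment.tendsto_unitDir (hv z₀) hz₀
    have hmin : Tendsto (fun j =>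
        min ‖‖w (ψ j) (-1) z‖⁻¹ • w (ψ j) (-1) z - ‖w (ψ j) (-1) z₀‖⁻¹ • w (ψ j) (-1) z₀‖
          ‖‖w (ψ j) (-1) z‖⁻¹ • w (ψ j) (-1) z + ‖w (ψ j) (-1) z₀‖⁻¹ • w (ψ j) (-1) z₀‖)
        atTop (𝓝 (min ‖‖W (-1) z‖⁻¹ • W (-1) z - e‖ ‖‖W (-1) z‖⁻¹ • W (-1) z + e‖)) :=
      ((hξz.sub hξz₀).norm).min ((hξz.add hξz₀).norm)
    have hle : ∀ᶠ j in atTop,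
        min ‖‖w (ψ j) (-1) z‖⁻¹ • w (ψ j) (-1) z - ‖w (ψ j) (-1) z₀‖⁻¹ • w (ψ j) (-1) z₀‖
          ‖‖w (ψ j) (-1) z‖⁻¹ • w (ψ j) (-1) z + ‖w (ψ j) (-1) z₀‖⁻¹ • w (ψ j) (-1) z₀‖ ≤
          1 / ((ψ j : ℝ) + 1) := by
      filter_upwards [hev_ball z, hev_ball z₀, hev_level z hz, hev_level z₀ hz₀] with j hb hb₀ hl hl₀
      exact halign (ψ j) z hb z₀ hb₀ hl hl₀
    have hmin0 : min ‖‖W (-1) z‖⁻¹ • W (-1) z - e‖ ‖‖W (-1) z‖⁻¹ • W (-1) z + e‖ ≤ 0 :=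
      le_of_tendsto_of_tendsto hmin hδ hle
    have hωz : W (-1) z = ‖W (-1) z‖ • (‖W (-1) z‖⁻¹ • W (-1) z) := by
      rw [smul_smul, mul_inv_cancel₀ (norm_ne_zero_iff.2 hz), one_smul]
    rcases le_total ‖‖W (-1) z‖⁻¹ • W (-1) z - e‖ ‖‖W (-1) z‖⁻¹ • W (-1) z + e‖ with hc | hc
    · rw [min_eq_left hc] at hmin0
      have : ‖W (-1) z‖⁻¹ • W (-1) z = e := sub_eq_zero.1 (norm_le_zero_iff.1 hmin0)
      refine ⟨‖W (-1) z‖, ?_⟩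
      conv_lhs => rw [hωz, this]
    · rw [min_eq_right hc] at hmin0
      have : ‖W (-1) z‖⁻¹ • W (-1) z = -e :=
        eq_neg_of_add_eq_zero_left (norm_le_zero_iff.1 hmin0)
      refine ⟨-‖W (-1) z‖, ?_⟩
      conv_lhs => rw [hωz, this]
      rw [smul_neg, neg_smul]
  exact not_singular_of_velocity_parallel_slice hW hWlaw h1 e hpar hWsing

/-! ### The one-slice unidirectionality leaf and the floor -/

/-- **ONE-SLICE UNIDIRECTIONALITY LEAF.** For all `C, K` there is `δ = δ(C,K) > 0` such that a
member of `𝒟_{C,K}` having ONE instant `t < 0` at which the velocity direction `û = w/‖w‖` is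
`δ`-coherent MODULO SIGN at all pairs of points of the parabolic ball `B(0, δ⁻¹√(−t))` where
`√(−t)‖w‖ > δ` is bounded on some backward cylinder at the origin (scale the instant to `−1`; then
`false_of_unidirectional_seq`). [cite: KochNadirashviliSereginSverak2009, §4 (arXiv:0709.3599 p. 8)] -/
theorem unidirectionality_leaf : ∀ (C K : ℝ), ∃ δ > 0,
    ∀ (w : ℝ → EuclideanSpace ℝ (Fin 3) → EuclideanSpace ℝ (Fin 3)),
      IsTypeIAncientMild C w →
      (∀ s : ℝ, s < 0 → ∫⁻ x, ‖fderiv ℝ (w s) x‖ₑ ^ 2 ≤ ENNReal.ofReal (K / Real.sqrt (-s))) →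
      (∃ t < 0, ∀ x ∈ ball (0 : EuclideanSpace ℝ (Fin 3)) (δ⁻¹ * Real.sqrt (-t)),
        ∀ y ∈ ball (0 : EuclideanSpace ℝ (Fin 3)) (δ⁻¹ * Real.sqrt (-t)),
          δ < Real.sqrt (-t) * ‖w t x‖ → δ < Real.sqrt (-t) * ‖w t y‖ →
          min ‖‖w t x‖⁻¹ • w t x - ‖w t y‖⁻¹ • w t y‖ ‖‖w t x‖⁻¹ • w t x + ‖w t y‖⁻¹ • w t y‖ ≤ δ) →
      ¬ (∀ ρ > 0, ∀ M : ℝ, ∃ t ∈ Ioo (-(ρ ^ 2)) (0 : ℝ),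
        ∃ x ∈ ball (0 : EuclideanSpace ℝ (Fin 3)) ρ, M < ‖w t x‖) := by
  intro C K
  by_contra hcon
  push Not at hcon
  choose w' hw' hlaw' hq' hsing' using hcon
  choose t' ht' hq' using hq'
  have hpos : ∀ k : ℕ, (0 : ℝ) < 1 / ((k : ℝ) + 1) := fun k => by positivity
  set w : ℕ → ℝ → EuclideanSpace ℝ (Fin 3) → EuclideanSpace ℝ (Fin 3) :=
    fun k => w' _ (hpos k) with hw_def
  have hw : ∀ k, IsTypeIAncientMild C (w k) := fun k => hw' _ (hpos k)
  have hlaw := fun k => hlaw' _ (hpos k)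
  have hsing := fun k => hsing' _ (hpos k)
  set t : ℕ → ℝ := fun k => t' _ (hpos k) with ht_def
  have ht : ∀ k, t k < 0 := fun k => ht' _ (hpos k)
  have hq := fun k => hq' _ (hpos k)
  set c : ℕ → ℝ := fun k => Real.sqrt (-t k) with hc_def
  have hc : ∀ k, 0 < c k := fun k => Real.sqrt_pos.2 (neg_pos.2 (ht k))
  have hc2 : ∀ k, c k ^ 2 = -t k := fun k => Real.sq_sqrt (neg_nonneg.2 (ht k).le)
  set v : ℕ → ℝ → EuclideanSpace ℝ (Fin 3) → EuclideanSpace ℝ (Fin 3) :=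
    fun k => nsRescale (c k) (w k) with hv_def
  have hv : ∀ k, IsTypeIAncientMild C (v k) := fun k => isTypeIAncientMild_nsRescale (hw k) (hc k)
  have hvlaw : ∀ k, ∀ s : ℝ, s < 0 →
      ∫⁻ x, ‖fderiv ℝ (v k s) x‖ₑ ^ 2 ≤ ENNReal.ofReal (K / Real.sqrt (-s)) :=
    fun k => RecurrentReductionD.dissipationLaw_nsRescale (hlaw k) (hc k)
  have hvsing : ∀ k, ∀ ρ > 0, ∀ M : ℝ, ∃ t ∈ Ioo (-(ρ ^ 2)) (0 : ℝ),
      ∃ x ∈ ball (0 : EuclideanSpace ℝ (Fin 3)) ρ, M < ‖v k t x‖ :=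
    fun k => RecurrentReductionD.singularAtOrigin_nsRescale (hsing k) (hc k)
  have e1 : ∀ k, c k ^ 2 * (-1 : ℝ) = t k := fun k => by rw [hc2]; ring
  have hvapp : ∀ (k : ℕ) (z : EuclideanSpace ℝ (Fin 3)), v k (-1) z = c k • w k (t k) (c k • z) := by
    intro k z
    rw [hv_def]
    dsimp only
    rw [nsRescale_apply, e1]
  have hball : ∀ k : ℕ, ∀ z ∈ ball (0 : EuclideanSpace ℝ (Fin 3)) ((k : ℝ) + 1),
      c k • z ∈ ball (0 : EuclideanSpace ℝ (Fin 3)) ((1 / ((k : ℝ) + 1))⁻¹ * Real.sqrt (-t k)) := by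
    intro k z hz
    rw [mem_ball_zero_iff] at hz ⊢
    rw [norm_smul, Real.norm_of_nonneg (hc k).le, one_div, inv_inv, hc_def, mul_comm]
    exact mul_lt_mul_of_pos_right hz (hc k)
  have hnorm : ∀ (k : ℕ) (z : EuclideanSpace ℝ (Fin 3)),
      ‖v k (-1) z‖ = Real.sqrt (-t k) * ‖w k (t k) (c k • z)‖ := by
    intro k z
    rw [hvapp, norm_smul, Real.norm_of_nonneg (hc k).le]
  have hdir : ∀ (k : ℕ) (z : EuclideanSpace ℝ (Fin 3)),
      ‖v k (-1) z‖⁻¹ • v k (-1) z = ‖w k (t k) (c k • z)‖⁻¹ • w k (t k) (c k • z) := by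
    intro k z
    rw [hvapp, norm_smul, Real.norm_of_nonneg (hc k).le, smul_smul, mul_inv, mul_comm (c k)⁻¹,
      mul_assoc, inv_mul_cancel₀ (hc k).ne', mul_one]
  have halign : ∀ k : ℕ, ∀ x ∈ ball (0 : EuclideanSpace ℝ (Fin 3)) ((k : ℝ) + 1),
      ∀ y ∈ ball (0 : EuclideanSpace ℝ (Fin 3)) ((k : ℝ) + 1),
        1 / ((k : ℝ) + 1) < ‖v k (-1) x‖ → 1 / ((k : ℝ) + 1) < ‖v k (-1) y‖ →
        min ‖‖v k (-1) x‖⁻¹ • v k (-1) x - ‖v k (-1) y‖⁻¹ • v k (-1) y‖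
            ‖‖v k (-1) x‖⁻¹ • v k (-1) x + ‖v k (-1) y‖⁻¹ • v k (-1) y‖ ≤ 1 / ((k : ℝ) + 1) := by
    intro k x hx y hy hlx hly
    rw [hnorm] at hlx hly
    rw [hdir, hdir]
    exact hq k (c k • x) (hball k x hx) (c k • y) (hball k y hy) hlx hly
  exact false_of_unidirectional_seq hv hvlaw hvsing halign

/-- **UNIDIRECTIONALITY FLOOR OF A FINITE-DISSIPATION TYPE-I SINGULARITY** (portrait clause of the
registered stub `stub_envelopeCriticalLiouville`): for all `C, K` there is `δ = δ(C,K) > 0` such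
that every SINGULAR member of `𝒟_{C,K}` has, at EVERY instant `t < 0`, two points of the parabolic
ball `B(0, δ⁻¹√(−t))` with scaled speed `√(−t)‖w‖ > δ` whose velocity directions are `δ`-apart
MODULO SIGN: the flow near a Type-I finite-dissipation singularity is never nearly a parallel
(shear) flow, at any scale. [cite: KochNadirashviliSereginSverak2009, §4 (arXiv:0709.3599 p. 8)] -/
theorem unidirectionality_floor_of_singular : ∀ (C K : ℝ), ∃ δ > 0,
    ∀ (w : ℝ → EuclideanSpace ℝ (Fin 3) → EuclideanSpace ℝ (Fin 3)),
      IsTypeIAncientMild C w →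
      (∀ s : ℝ, s < 0 → ∫⁻ x, ‖fderiv ℝ (w s) x‖ₑ ^ 2 ≤ ENNReal.ofReal (K / Real.sqrt (-s))) →
      (∀ ρ > 0, ∀ M : ℝ, ∃ t ∈ Ioo (-(ρ ^ 2)) (0 : ℝ),
        ∃ x ∈ ball (0 : EuclideanSpace ℝ (Fin 3)) ρ, M < ‖w t x‖) →
      ∀ t < 0, ∃ x ∈ ball (0 : EuclideanSpace ℝ (Fin 3)) (δ⁻¹ * Real.sqrt (-t)),
        ∃ y ∈ ball (0 : EuclideanSpace ℝ (Fin 3)) (δ⁻¹ * Real.sqrt (-t)),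
          δ < Real.sqrt (-t) * ‖w t x‖ ∧ δ < Real.sqrt (-t) * ‖w t y‖ ∧
          δ < ‖‖w t x‖⁻¹ • w t x - ‖w t y‖⁻¹ • w t y‖ ∧
          δ < ‖‖w t x‖⁻¹ • w t x + ‖w t y‖⁻¹ • w t y‖ := by
  intro C K
  obtain ⟨δ, hδ, h⟩ := unidirectionality_leaf C K
  refine ⟨δ, hδ, fun w hw hlaw hsing t ht => ?_⟩
  by_contra hcon
  push Not at hcon
  refine h w hw hlaw ⟨t, ht, fun x hx y hy hlx hly => ?_⟩ hsing
  rcases le_or_gt ‖‖w t x‖⁻¹ • w t x - ‖w t y‖⁻¹ • w t y‖ δ with h1 | h1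
  · exact (min_le_left _ _).trans h1
  · exact (min_le_right _ _).trans (hcon x hx y hy hlx hly h1)

end Summit.NavierStokesRegularity.NavierStokesRegularity.Theorems.FiniteDissipationLiouville.Unidirectional

end
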